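import Mathlib
import Summits.Ventures.PercRepro2.SwOutAll
import Summits.Ventures.PercRepro2.SwOutArmFlip
import Summits.Ventures.PercRepro2.SwOutArms
import Summits.Ventures.PercRepro2.SwOutArmOrbit
import Summits.Ventures.PercRepro2.SwOutArmCube
import Summits.Ventures.PercRepro2.SwOutArmThm
import Summits.Ventures.PercRepro2.SwOutJunctionFine
import Summits.Ventures.PercRepro2.SwOutJunctionRegion
import Summits.Ventures.PercRepro2.SwOutJunction
import Summits.Ventures.PercRepro2.SwOutJunctionsSplit
import Summits.Ventures.PercRepro2.SwOutJunctionsFine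
import Summits.Ventures.PercRepro2.SwOutJunctionsRegion
import Summits.Ventures.PercRepro2.SwOutJunctions
import Summits.Ventures.PercRepro2.SwOutAdjSplit
import Summits.Ventures.PercRepro2.SwOutAdjFine
import Summits.Ventures.PercRepro2.SwOutAdjRegion
import Summits.Ventures.PercRepro2.SwOutAdjMatched
import Summits.Ventures.PercRepro2.SwOutAdjCongr
import Summits.Ventures.PercRepro2.SwOutAdjBlock
import Summits.Ventures.PercRepro2.SwOutAdjIneq

/-!
# THE ADJACENT-JUNCTION THEOREM (blind cell PercRepro2, night-4 g11, 2026-08-25;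
proofs/NIGHT4-G11.md §5(5))

A region `U ∋ h` (`l ∉ U`, no loop at `h`) with a set `J ⊆ U ∖ {h, o}` of junctions — ANY set,
adjacent junctions allowed — such that every neighbour `p ≠ h` of a junction (junction neighbours
included) is adjacent to `h`, and every other vertex of `U ∖ {h, o}` has an outside edge or no
edge: every class satisfies the rigid counting inequality of (HLC) (`rigidOK_of_adjJunctions`).
Proof: the class is partitioned by `ζ ↦ (aSet ζ, blockBase ζ)` into blocks, each the product cube
«arms of the graph split at the matched set ⊕ internal edges» (`SwOutAdjBlock`), on which the
rigid inequality holds (`card_block_le`, Harris on the product cube).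
-/

namespace Summit.Ventures.PercRepro2

namespace LocRows

open Hull

variable {V : Type*} {E : Type*} [Fintype E] [DecidableEq E]

open scoped Classical

section Main

variable {ends : E → Sym2 V} {U : Set V} {ξ : Config E} {l h o : V} {J : Set V}

variable (hl : l ∉ U) (hloop_h : ∀ e, ends e ≠ s(h, h)) (hJU : J ⊆ U) (hhJ : h ∉ J)
  (hadj : ∀ u ∈ J, ∀ e (he : u ∈ ends e), Sym2.Mem.other he ≠ h →
    ∃ e', ends e' = s(Sym2.Mem.other he, h))
  (hout : ∀ x ∈ U, x ≠ h → x ≠ o → x ∉ J →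
    (∃ e y, ends e = s(x, y) ∧ y ∉ U) ∨ (∀ e, x ∉ ends e))

include hJU hhJ hadj hout in
/-- **The fibre of `ζ ↦ (aSet ζ, blockBase ζ)` through `ζ₁` is its block** (within the side
`Q`). -/
theorem fibre_eq_block {ζ₁ : Config E} (hζ₁ : ζ₁ ∈ swOutSide ends l h o U ξ)
    (P : Config E → Prop) :
    ((swOutSide ends l h o U ξ).filter P).filter
        (fun ζ => (aSet ends J h ζ, blockBase ends (aSet ends J h ζ) h ζ) =
          (aSet ends J h ζ₁, blockBase ends (aSet ends J h ζ₁) h ζ₁)) =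
      (Finset.univ.image (blockReal ends (aSet ends J h ζ₁) h ζ₁)).filter
        fun ζ' => ζ' ∈ tgtU ends l h {S : Set V | o ∈ S} ∧ P ζ' := by
  ext ζ'
  simp only [Finset.mem_filter, Finset.mem_image, Finset.mem_univ, true_and, Prod.mk.injEq]
  constructor
  · rintro ⟨⟨hζ', hP⟩, hMeq, hbase⟩
    refine ⟨?_, (mem_swOutSide.1 hζ').1, hP⟩
    rw [hMeq] at hbase
    have hc' : CoreFree (splitEndsS ends (aSet ends J h ζ₁))
        (normRed ends (aSet ends J h ζ₁) ζ') (Sum.inl h) := by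
      rw [← hMeq]; exact coreFree_normRed hhJ hout hζ'
    obtain ⟨ω', hω'⟩ := exists_orbitReal_eq hc' hbase
    refine ⟨Sum.elim ω' (fun e => ζ' e.1), ?_⟩
    funext e
    by_cases hi : Internal ends (aSet ends J h ζ₁) e
    · rw [blockReal_of_internal _ hi]
      rfl
    · rw [blockReal_of_not_internal _ hi]
      have hcomp : (Sum.elim ω' fun e : {e : E // Internal ends (aSet ends J h ζ₁) e} => ζ' e.1) ∘
          Sum.inl = ω' := funext fun _ => rfl
      rw [hcomp, hω', normRed_of_not_internal hi]
  · rintro ⟨⟨ω, rfl⟩, hQ', hP'⟩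
    refine ⟨⟨mem_swOutSide.2 ⟨hQ', blockReal_mem_outClass hJU hhJ hadj hout hζ₁ ω⟩, hP'⟩,
      aSet_blockReal hhJ hadj hout hζ₁ ω, ?_⟩
    rw [aSet_blockReal hhJ hadj hout hζ₁ ω]
    unfold blockBase
    rw [normRed_blockReal ω, allRed_orbitReal (coreFree_blockBase hhJ hout hζ₁) _]
    exact allRed_idem (coreFree_normRed hhJ hout hζ₁)

include hl hloop_h hJU hhJ hadj hout in
/-- **THE ADJACENT-JUNCTION THEOREM**: the rigid counting inequality of (HLC) on every class of a
region with a set `J` of junctions (adjacent junctions allowed; no loop at `h`, `h ∉ J`, every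
neighbour `p ≠ h` of a junction — junction neighbours included — adjacent to `h`, every vertex of
`U ∖ {h, o}` outside `J` with an outside edge or no edge). -/
theorem rigidOK_of_adjJunctions {𝓔 : Set (Set E)} (h𝓔 : IsUpperSet 𝓔) :
    ((swOutSide ends l h o U ξ).filter fun ζ => redEdges ends ζ h ∈ 𝓔).card ≤
      ((swOutSide ends l h o U ξ).filter fun ζ => blueEdges ends ζ h ∈ 𝓔).card := by
  let key : Config E → Set V × Config E := fun ζ =>
    (aSet ends J h ζ, blockBase ends (aSet ends J h ζ) h ζ)
  let S₀ : Finset (Set V × Config E) := (swOutSide ends l h o U ξ).image key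
  have hmap : ∀ (P : Config E → Prop) (ζ : Config E),
      ζ ∈ (swOutSide ends l h o U ξ).filter P → key ζ ∈ S₀ :=
    fun P ζ hζ => Finset.mem_image_of_mem key (Finset.mem_filter.1 hζ).1
  rw [Finset.card_eq_sum_card_fiberwise (hmap _), Finset.card_eq_sum_card_fiberwise (hmap _)]
  refine Finset.sum_le_sum fun k hk => ?_
  obtain ⟨ζ₁, hζ₁, rfl⟩ := Finset.mem_image.1 hk
  rw [fibre_eq_block hJU hhJ hadj hout hζ₁, fibre_eq_block hJU hhJ hadj hout hζ₁]
  exact card_block_le hl hloop_h hJU hhJ hadj hout hζ₁ h𝓔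

end Main

end LocRows

end Summit.Ventures.PercRepro2
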